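import Mathlib
import HarnessLib
import HarnessLib.Audit
import Summits.QuantumFields.Statement
import Summits.QuantumFields.YangMills.Theses.BalabanLadder

/-!
Route: LogConcaveChart

DORMANT since 2026-09-03T06:22:52Z (reconciler: no traction for 5 d (last activity statement-closed at 2026-08-29T05:28:00Z); parked, not closed — `ledger route dormant route-QuantumFields-LogConcaveChart --off` to reactivate) — unstaffed, not closed; items shared with open routes are served there. `ledger route dormant <id> --off` reactivates.

# Route LogConcaveChart — NT clause (i) from a Hessian sandwich of the unit-scale coarse-grained
action — floors from ceilings by log-concave comparison

RUNG LINE (D-0145 ideator seat ym-idea-8 generation 2, LINE 3, technique card «dual» read as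
Loewner-order / transport DUALITY: a covariance FLOOR is the image of a Hessian CEILING under the
order-reversing map H ↦ H⁻¹; bears_on LADDER-YM R2a = leaf
`Summit.QuantumFields.YangMills.Theses.BalabanLadder.NT`, item stmt-QuantumFields-19353; NO summit
is proved by this line — NT is one binder of the spine's `closes`, and NT's clause (ii) enters only
through the declared RESIDUAL crux `SkewAtChartUnit`). It suffices to show X = X₁ ∧ X₂ ∧ X₃: (X₁,
deciding, `UnitScaleChart`, ENGINE) for every compact simple G a geometric constant K and, for every
accuracy δ > 0, a unit a → 0⁺ (a flow-defined deep-UV unit, finer the smaller δ), a positive-time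
Schwartz mode v and ε > 0 such that on every large torus at every large β the Wilson measure admits
a measurable chart Φ into some ℝⁿ whose law is, up to weighted total variation ε, a CENTRED Gibbs
density e^(−A) with SECOND DIFFERENCES SANDWICHED in (1±δ)·H₀, in which the conditional expectations
of the unit-smeared action densities of the mirror pair (ϑv, v) are quadratic(+linear) forms f, g up
to relative L² error Kδ, whose chart covariance Cov_ν(f,g) is within ε of NT's `Q2 G r β L (a β)
(thetaTest 4 v) v`, and whose centred-Gaussian proxy rC = 2 tr(H₀⁻¹H_f H₀⁻¹H_g) + b_fᵀH₀⁻¹b_g is ≥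
8ε with Gaussian variances ≤ Kε; (X₂, `QuadraticCovarianceComparison`, PURE PROBABILITY on ℝⁿ,
dimension-free) under such a sandwich |Cov_ν(f,g) − rC| ≤ C·δ·√(rV_f·rV_g); (X₃, residual) NT clause
(ii) at any unit carrying a chart package. Then with δ := min(δ₀, 1/((|C|+1)K)) the floor is
MANUFACTURED: Q2 ≥ Cov_ν − ε ≥ rC − |C|δKε − ε ≥ 6ε (item `Assembly`, bookkeeping). Every engine
debt in X₁ is a CEILING, a SANDWICH or an explicit Gaussian number; the only lower bound on a
non-Gaussian expectation in the whole line is produced by X₂ from convexity.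
Lean: `QuadraticCovarianceComparison → UnitScaleChart → SkewAtChartUnit →
Summit.QuantumFields.YangMills.Theses.BalabanLadder.NT`

## Assembly
Bookkeeping over ℝ: take C, δ₀ from QuadraticCovarianceComparison; for G take K from UnitScaleChart
and put δ := min δ₀ (1/((|C|+1)·K)) (so 0 < δ ≤ 1 and |C|·δ·K ≤ 1); obtain r, a, v, ε, β₅, Λ₅; at
admissible (β, L) the chart's hypotheses are exactly those of the comparison, so |Cov_ν(f,g) − rC| ≤
Cδ√(rV_f rV_g) ≤ |C|δKε ≤ ε, hence Cov_ν(f,g) ≥ 7ε and Q2 ≥ 6ε ≥ ε: clause (i) of `LowerBounds G r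
a` with the witnesses (v, ε, β₅, Λ₅); clause (ii) is SkewAtChartUnit applied to (r, a) and the
package (K, δ, v, ε). The `letI := borel G` instances of NT are reproduced verbatim in every item,
so `Q2` terms match syntactically.

CLOSES_TARGET: closes rung R2a of QuantumFields: Summit.QuantumFields.YangMills.Theses.BalabanLadder.NT (D-0061; not the summit Statement) — the deciding theorem of this route concludes that registered leaf instead of the Statement decl `YangMills` (class rung: servable and labelled, never counted as concluding the summit Statement).

Rationale: WHY THIS LINE. Mechanism: uniform log-concavity is stable information that survives renormalisation
in SUP-NORM form (Bałaban's small-field effective actions are analytic with Cauchy bounds on second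
derivatives, Balaban1988RG2Cluster, Balaban1989LargeFieldII), and log-concave comparison converts a
two-sided Hessian bound into a two-sided COVARIANCE bound for quadratic observables with a
DIMENSION-FREE constant: the Brenier map T from N(0,H₀⁻¹) to ν = e^(−A) has ‖DT‖ ≤ (1−δ)^(−1/2) and
‖DT⁻¹‖ ≤ (1+δ)^(1/2) by the two-potential form of Caffarelli's contraction theorem (Caffarelli2000;
Kolesnikov arXiv:1103.1479 Thm 2.2: sup Φ_ee² ≤ K⁻¹ sup V_ee), so T = id + e with De symmetric, ‖De‖
≤ δ and E e = 0 (centring), and the Gaussian Poincaré inequality applied to f∘T − f bounds the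
covariance defect by Cδ√(Var_γ f · Var_γ g) (the e-term is controlled direction-by-direction in the
eigenbasis of H_f, which is what removes the dimension). Imported areas: optimal transport /
log-concave measures (Caffarelli2000, arXiv:1103.1479, BrascampLieb1976, HelfferSjostrand1994 as the
alternative random-walk-representation proof) into constructive gauge theory (Balaban1987RG1,
Balaban1988RG2Cluster, Balaban1989LargeFieldII). What it does that listed routes do not: every other
NT(i) line in the tree obtains the floor from a POSITIVE-TYPE witness (RP Cauchy–Schwarz with loops,
characters, events, finite-rank traces, Markov/martingale transfer: StaticSourceWitness,
FiniteRankMirror, card markov-mirror-transfer, card moderate-deviation-event-witness), from a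
RESPONSE/TILT identity (cards feynman-hellmann-slab-skewness, delta-sandwich-conjugate-response,
thermodynamic-curvature-response; route ForcedResponseSkewness), from RUNNING/step laws
(OctaveRunning, GradientFlowWitness, ThermalDescent) or from a two-sided PERTURBATIVE EXPANSION of
the covariance itself (line of record CFPW, Cruxes/NT/Lines/birth.md); here no expansion of any
expectation is performed and no positive functional is exhibited — the floor is the dual image of a
ceiling on the effective action. Negatives index: nothing self-normalised (18944), no diagonal-plane
RP (9665), no curvature anchor (15826).

RANKED CRUXES. #2 UnitScaleChart (crux) — DECIDING (ENGINE; ∃-package). For every compact simple G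
there is K > 0 such that for every δ > 0 there are a lattice representation r, a unit a (positive, →
0), a real Schwartz mode v with tsupport in {y₀ > 0} and ε > 0, thresholds β₅, Λ₅, such that for β ≥
β₅ and tori with a(β)·L ≥ Λ₅ there exist n, a measurable chart Φ : GaugeConfig 4 (2L+1) G → ℝⁿ,
matrices H₀ ≻ 0, H_f, H_g symmetric, vectors b_f, b_g and a continuous A : ℝⁿ → ℝ with: second
differences of A sandwiched in (1±δ)·hᵀH₀h; ∫ x_i e^(−A) = 0; |∫ F∘Φ dμ_(β,L) − E_ν F| ≤ ε·M for
every measurable F with |F(y)| ≤ M(1+‖y‖⁴) (weighted-TV law closeness to ν = e^(−A)dx/Z); ∫ (E_μ[A_f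
| Φ] − f∘Φ)² dμ ≤ Kδ·rV_f for A_f = Σ_y (ϑv)(a(β)y)·dens_y and f(x) = xᵀH_f x + b_fᵀx, likewise for
(v, g); |Q2 G r β L (a β) (ϑv) v − Cov_ν(f,g)| ≤ ε; rC ≥ 8ε, 0 ≤ rV_f ≤ Kε, 0 ≤ rV_g ≤ Kε (rC, rV
the N(0,H₀⁻¹) covariance/variances of f, g). Intended witness: the flow-defined unit (stop Bałaban's
iteration at the first step whose rigorously bracketed running coupling exceeds a target γ*; AF
makes 1/g_k² decrease by ≥ b₀ log 2 per step inside the controlled regime), a WINDOWED block-field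
chart at scale unit/M around the mirror pair (n fixed), A = the window's coarse-grained action with
the large-field region replaced by its quadratic continuation (mass e^(−c/γ*) ≪ ε ~ κγ*⁴ accounts
for the weighted-TV defect), H₀ = the window Schur complement of the unit-lattice Gaussian form.
[difficulty: open-problem] (why it might fail: the sup-norm Hessian sandwich of the window-marginal
action needs cluster-expansion control of the outside integration given the window field to relative
precision γ*log(1/γ*) — completion-of-Bałaban debt, never printed (UVStabilityNonUniqueness); large
fields inside the window may force δ = O(1).) [Balaban1988RG2Cluster, Balaban1989LargeFieldII,
Balaban1987RG1, MagnenRivasseauSeneor1993]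
#3 QuadraticCovarianceComparison (crux) — PURE PROBABILITY (dimension-free log-concave comparison).
There are C and δ₀ ∈ (0,1] such that for 0 ≤ δ ≤ δ₀, every n, H₀ ≻ 0, symmetric H_f, H_g, vectors
b_f, b_g and continuous A : ℝⁿ → ℝ with second differences sandwiched in (1±δ)·hᵀH₀h and ∫ x_i
e^(−A) dx = 0 for all i: |Cov_ν(f,g) − rC| ≤ C·δ·√(rV_f·rV_g), where ν = e^(−A)dx/Z, f = xᵀH_f x +
b_fᵀx, g = xᵀH_g x + b_gᵀx, rC = 2 tr(H₀⁻¹H_f H₀⁻¹H_g) + b_fᵀH₀⁻¹b_g and rV_f, rV_g the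
corresponding Gaussian variances. δ = 0 is exact (A is then ½xᵀH₀x + const by centring; Isserlis).
[difficulty: L] (why it might fail: dimension-freeness rests on the two-sided Caffarelli–Kolesnikov
bound for a NON-Gaussian source (‖DT⁻¹‖ ≤ √(1+δ)) under C^(1,1)-only potentials plus E e = 0 from
centring; a hidden √n in the e-term would make δ* volume-dependent and kill the assembly.)
[Caffarelli2000, arXiv:1103.1479, BrascampLieb1976, HelfferSjostrand1994]
#4 SkewAtChartUnit (crux) — RESIDUAL (declared; NT clause (ii) pinned to the chart unit). For every
compact simple G, every r and unit a (positive, → 0): IF (r,a) carry a chart package of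
UnitScaleChart's body for some K > 0, 0 < δ ≤ 1, mode v and floor ε THEN clause (ii) of `LowerBounds
G r a` holds (three Schwartz functions with pairwise disjoint supports and ε' > 0 with ε' ≤ |Q3 G r
β L (a β) f g h| eventually). It is NT(ii) at a deep-UV unit and is priced as such; the line claims
nothing about it beyond pinning the unit. [deps: UnitScaleChart] [difficulty: open-problem] (why it
might fail: it is NT clause (ii) under a unit-pinning hypothesis; at a deep-UV unit the connected
three-point function is O(γ*)-suppressed relative to two-point data and could extinguish along the
unit (BoundedSkewnessRunning's bet); tree-level skewness vanishes (`treeLevelSkewness_vanishes`).)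
[Balaban1989LargeFieldII, MagnenRivasseauSeneor1993, OsterwalderSeiler1978]

TWO-LAYER PLAN. Once QuadraticCovarianceComparison is taken: UnitScaleChart ⇐ FlowUnit → WindowChart
→ UnitScaleChart with FlowUnit = «a unit a(β) → 0 at which Bałaban's bracketed running coupling lies
in [γ*/4, γ*] uniformly in β» (two-sided beta-function step bounds) and WindowChart = «at such a
unit the window-marginal block-field action is (1±Cγ* log(1/γ*))-sandwiched around its
Schur-complement Gaussian form, with weighted-TV large-field defect e^(−c/γ*) and relative-L²
quadraticity of E[dens | window field]»; glue = choice of γ* from δ. QuadraticCovarianceComparison ⇐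
TwoSidedContraction (‖DT‖, ‖DT⁻¹‖) → PoincaréDefect → crux.

KILL CRITERIA. Refutation of QuadraticCovarianceComparison (a dimension-dependent lower bound for
the covariance defect of quadratic forms under (1±δ)-sandwiched centred measures, e.g. a
product-measure counterexample with defect ≫ δ√(rV_f rV_g)) closes the route outright (close
--reason refuted:QuadraticCovarianceComparison) — the whole point is dimension-freeness. Refutation
of UnitScaleChart in the Gaussian/abelian toy (U(1) or lattice-Maxwell analogue: the windowed
block-field marginal of a Gaussian is NOT sandwiched around its Schur complement — impossible, it is
exact) would indicate a mis-typing, not a kill; a proof that Bałaban-type window marginals cannot be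
sup-norm sandwiched at any fixed γ* (large fields inside the window forcing δ ≥ O(1)) forces the
pivot «sandwich on a high-probability ball + local transport» (new crux, same route).
SkewAtChartUnit refuted ⇒ NT itself fails at deep-UV units for that unit family; pivot to a coarser
unit is then the spine's problem, not this line's.

NOT DECOMPOSED YET. The flow-defined unit (two-sided running-coupling control), the
window/Schur-complement bookkeeping, the large-field continuation of A, the conditional
decorrelation at mirror distance (chart scale unit/M), and the choice of v with κ = rC/√(rV_f rV_g)
bounded below (free-lattice reflection positivity of quadratic forms) are all inside UnitScaleChart
and deliberately not itemised at open (layer-2 children after the comparison crux closes). The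
alternative Helffer–Sjöstrand / Brascamp–Lieb proof of the comparison is a line on that crux, not an
item.

CHEAPEST FALSIFIER. For QuadraticCovarianceComparison: n = 1 and product measures — take A(x) = Σ_i
a(x_i) with a'' ∈ [1−δ, 1+δ], f = g = Σ_i x_i² (H_f = I): the defect is n·(Var_ν₁(x²) − 2) versus C
δ √(2n·2n) = 2Cδn — both linear in n, ratio (Var_ν₁(x²) − 2)/(2δ) must stay bounded as δ → 0: for
a(x) = (1+δ cos x)-type perturbations Var(x²) − 2 = O(δ) ✓ (checked by hand: first-order
perturbation of a Gaussian fourth moment is O(δ)); a refuter runs the exact 1-d quadrature for a'' =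
1 + δ·sign-pattern extremisers. For UnitScaleChart: the lattice-Maxwell (Gaussian) toy must give δ =
0, rC = the exact mirror covariance > 0 for a positive-time v by free-field RP — a desk computation;
if rC ≤ 0 for all admissible v at the Schur-complement level the proxy floor is dead.

NUMBERS. δ* = min(δ₀, 1/((|C|+1)K)) with δ₀ ≤ 1/2 natural (then ‖De‖ ≤ δ); K ≥ 8 forced by
Cauchy–Schwarz (rC ≤ √(rV_f rV_g)); engine side δ(γ*) ≈ C_H γ* log(1/γ*), ε ≈ κγ*⁴/8, large-field
mass e^(−c/γ*); SU(2): b₀ = 11/(24π²), unit of record u(β) = e^(−β/(4b₀))(β/(2b₀))^(b₁/(2b₀²))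
(BalabanLadder.UVSeamRec) — the chart unit is u/M_δ, still a unit.

DEFINITION REQUESTS. None: all chart-side objects (Gibbs expectation on ℝⁿ, quadratic forms,
Gaussian proxies) are written with `let` over Mathlib (`Matrix.PosDef`, `Matrix.IsSymm`,
`Matrix.trace`, `dotProduct`, `Matrix.mulVec`, `MeasureTheory.condExp`, `wilsonMeasure`,
`torusLift`, `dens`, `Q2`, `Q3`).

Novelty: Searches (2026-08-28): lit search --hybrid "Caffarelli contraction theorem optimal transport
Lipschitz log-concave perturbation Gaussian" (6 docs: BakryGentilLedoux2013 pp.450–452, GAFA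
2011/2017/2020 volumes); lit search "Kolesnikov mass transportation contractions" (held:
paper:arxiv-1103.1479, arxiv-1910.09035 Colombo–Fathi–type bounds); lit search --hybrid "lattice
Yang-Mills log-concave Bakry-Emery strong coupling mass gap Langevin" (6 docs, textbooks only;
ShenZhuZhu2022/2023 known from bib: Bakry–Émery for lattice YM at STRONG coupling); lit vsearch
"covariance of quadratic forms under a uniformly log-concave perturbation … dimension free" (8 docs,
none on point); lit galaxy search "Caffarelli contraction|Caffarelli's contraction|contraction
theorem of Caffarelli" --star all (13 rows: BGL, GAFA volumes; no gauge-theory use); lit galaxy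
search "log-concave|log-concavity" --star pdf --title-contains "Yang-Mills" (8 rows, none relevant);
tree: rg over Summits/QuantumFields (no `Caffarelli`, `Brenier`, `log-concave` chart in any NT
route; cards delta-sandwich-conjugate-response and thermodynamic-curvature-response are zeroth-order
density sandwiches / response identities on one femto cube).
Nearest prior art found: [corpus:paper:arxiv-1103.1479 p.4 Thm 2.2] (two-potential Caffarelli bound
— the tool, never pointed at a renormalised gauge action); ShenZhuZhu2022 / ShenZhuZhu2023
(log-concavity = Bakry–Émery of the BARE Wilson measure at strong coupling, used for uniqueness/  [refs: paper:arxiv-1103.1479, arxiv-1910.09035, ShenZhuZhu2022, ShenZhuZhu2023]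

Barriers (technique_class: log-concavity, transport-comparison, RG-chart): - technique_class: log-concavity, transport-comparison, RG-chart
- Literature.Barriers.QuantumFields.PerturbativeInvisibility: outside its class — no quantity is
Taylor-expanded at g = 0; the floor ε ≈ κγ*⁴ lives at a FLOW-DEFINED deep-UV unit where the running
coupling is small but FIXED, and dimensional transmutation enters only through the definition of
that unit by Bałaban's bracketed flow (the barrier's flat function e^(−1/(2b₀g²)) is never
differentiated); the bet is that a unit finer than physical is still a unit for NT (it is: NT
quantifies ∃ a).
- Literature.Barriers.QuantumFields.UVStabilityNonUniqueness: UnitScaleChart sits INSIDE its warning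
(observable-level/structural output of Bałaban's density stability is announced, never printed); the
line asks for the output in SUP-NORM HESSIAN form on a fixed window, which is the form closest to
what the inductive analyticity bounds already give, and asks for no limit and no uniqueness.
- Literature.Barriers.QuantumFields.StochasticQuantisationCriticality: not in its class — no
Langevin dynamics in infinite volume or at criticality is used; the only dynamics-flavoured object
is a finite-dimensional transport map on the chart.
- Literature.Barriers.QuantumFields.FixedCouplingUltralocality: not in its class — every statement
is along a(β) → 0 with β → ∞ on tori.
- Literature.Barriers.QuantumFields.MigdalKadanoffGroupBlindness: no approximate recursion; G enters
through IsCompactSimpleLieGroup, r and the residual.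
- Literatur

History (route lifecycle, newest last):
- 2026-08-28T07:42:25Z · rev 1: restated UnitScaleChart (stmt-QuantumFields-26239) — repair per idea-crit-9 VERDICT #15 (PASS-WITH-PRICE + repair request): field (5) |Q2 − Cov_ν| ≤ ε REMOVED; chart-side ceilings (law closeness on f,g,fg; conditi (planner-ym-idea-8-g2-0)
- 2026-08-28T07:43:51Z · rev 2: restated SkewAtChartUnit (stmt-QuantumFields-26241) — rev 1 sync: SkewAtChartUnit's hypothesis was the OLD chart package (with the removed field (5)); it now quotes the repaired package verbatim so the Assembly can (planner-ym-idea-8-g2-0)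
- 2026-08-28T07:46:31Z · rev 3: restated Assembly (stmt-QuantumFields-26242) — rev 1 completion of the VERDICT #15 repair: Assembly now consumes ChartCovarianceTransfer (26680) — QCC → ChartCovarianceTransfer → UnitScaleChart → SkewAtChart (planner-ym-idea-8-g2-0)
- 2026-08-28T08:11:23Z · rev 4: restated UnitScaleChart (stmt-QuantumFields-26725) — repair r2 (self-found typing artefact while proving the Assembly): rev 1's «let mΦ : MeasurableSpace … := comap Φ …» acted as a LOCAL INSTANCE, so «Measurable Φ (planner-ym-idea-8-g2-0)
- 2026-08-28T08:12:31Z · rev 5: restated SkewAtChartUnit (stmt-QuantumFields-26750) — repair r2 sync: SkewAtChartUnit's hypothesis quotes the rev-2 UnitScaleChart package verbatim (comap inlined; no class-typed let) so the Assembly feeds it from (planner-ym-idea-8-g2-0)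
- 2026-09-03T06:22:52Z · DORMANT — reconciler: no traction for 5 d (last activity statement-closed at 2026-08-29T05:28:00Z); parked, not closed — `ledger route dormant route-QuantumFields-LogConc (operator:999:698296)

sub-problem: YangMills · status: dormant · opened planner-ym-idea-8-g2-0 2026-08-28T06:31:32Z · rev 6 · ledger route-QuantumFields-LogConcaveChart
GENERATED by the gate from the ledger (D-0016/17). Provers cite these decls: `theorem foo : Summit.QuantumFields.YangMills.Theses.LogConcaveChart.<Decl> := …` in Summits/QuantumFields/YangMills/Theorems/<Name>.lean.
-/

namespace Summit.QuantumFields.YangMills.Theses.LogConcaveChart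

open scoped BigOperators Topology Manifold Classical MeasureTheory ProbabilityTheory Matrix InnerProductSpace ComplexConjugate ContinuousMap
open Filter Set Function TopologicalSpace MeasureTheory

attribute [summit_statement] _root_.YangMills
attribute [summit_statement] _root_.Summit.QuantumFields.YangMills.Theses.BalabanLadder.NT

/-! Retired items kept as plain definitions (history; not obligations of this route): landed proofs / closed glue still name them. -/

/-- retired stmt-QuantumFields-23667 (moot, gen 1) — named by an active item. -/
def SandwichTransportMap : Prop :=
  open MeasureTheory in ∀ δ : ℝ, 0 ≤ δ → δ ≤ 1 / 2 → ∀ (n : ℕ) (H₀ : Matrix (Fin n) (Fin n) ℝ) (A : (Fin n → ℝ) → ℝ), H₀.PosDef → Continuous A → (∀ x h : Fin n → ℝ, (1 - δ) * (h ⬝ᵥ H₀.mulVec h) ≤ A (x + h) + A (x - h) - 2 * A x ∧ A (x + h) + A (x - h) - 2 * A x ≤ (1 + δ) * (h ⬝ᵥ H₀.mulVec h)) → ∃ T : (Fin n → ℝ) → (Fin n → ℝ), ContDiff ℝ 1 T ∧ (∀ F : (Fin n → ℝ) → ℝ, Measurable F → (∫ x, F (T x) * Real.exp (-(x ⬝ᵥ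 H₀.mulVec x) / 2)) / (∫ x : Fin n → ℝ, Real.exp (-(x ⬝ᵥ H₀.mulVec x) / 2)) = (∫ x, F x * Real.exp (-A x)) / ∫ x, Real.exp (-A x)) ∧ (∀ x y : Fin n → ℝ, (T x - T y - (x - y)) ⬝ᵥ H₀.mulVec (T x - T y - (x - y)) ≤ δ ^ 2 * ((x - y) ⬝ᵥ H₀.mulVec (x - y))) ∧ (∀ x u : Fin n → ℝ, (fderiv ℝ T x u - u) ⬝ᵥ H₀.mulVec (fderiv ℝ T x u - u) ≤ δ ^ 2 * (u ⬝ᵥ H₀.mulVec u))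

-- earlier UnitScaleChart (stmt-QuantumFields-26239, replaced 2026-08-28T07:42:25Z -> stmt-QuantumFields-26725): retired by None — open MeasureTheory Literature.MathematicalPhysics.QuantumFieldTheory Literature.MathematicalPhysics.QuantumLattice Literature.Probability.LatticeModels Summit.QuantumFields.YangMills.Cruxes.OSLegsFromFemtoAndGap.DlrCollarTransfer in ∀ (G : Type) [Group G] [TopologicalSpac
-- earlier UnitScaleChart (stmt-QuantumFields-26725, replaced 2026-08-28T08:11:23Z -> stmt-QuantumFields-26931): retired by None — open MeasureTheory Literature.MathematicalPhysics.QuantumFieldTheory Literature.MathematicalPhysics.QuantumLattice Literature.Probability.LatticeModels Summit.QuantumFields.YangMills.Cruxes.OSLegsFromFemtoAndGap.DlrCollarTransfer in ∀ (G : Type) [Group G] [TopologicalSpac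
/-- item stmt-QuantumFields-26931 · crux · rank 2 · open · by planner
why it might fail: Completion-of-Bałaban in chart language: bounded Borel coarse chart, δ-log-concave Hessian sandwich, conditional quadraticity AND conditional decorrelation across the mirror given σ(Φ), degree-4 law closeness — unprinted (UVStabilityNonUniqueness wall); any one may fail at the unit where rC ≥ 8ε.
sources: Balaban1988RG2Cluster
[crux] (rev 2 of the repaired chart; typing artefact of rev 1 removed) log-concave coarse-graining
chart at a flow-defined unit: ∃ K ∀ δ>0 ∃ unit a → 0, positive-time mode v, scale ε>0, ∀ large β, L:
a BOUNDED BOREL-measurable chart Φ of the Wilson measure μ into ℝⁿ and a centred model density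
e^(−A) with second differences sandwiched in (1±δ)H₀ such that for the unit-smeared action densities
Af, Ag of the mirror pair (ϑv, v) (bounded, Borel measurable; Q2 = Cov_μ(Af,Ag) recorded as an
identity) and the explicit quadratic(+linear) forms f, g: law closeness on the needed degree-4
polynomials (μ-covariance of f∘Φ, g∘Φ within ε of the model covariance; μ-variances ≤ Kε),
conditional quadraticity ‖μ[Af|σ(Φ)] − f∘Φ‖²₂ ≤ δε (same for g), conditional decorrelation across
the mirror gap |E_μ[Cov(Af,Ag|σ(Φ))]| ≤ ε, proxy floor rC ≥ 8ε with Gaussian variances ≤ Kε; σ(Φ) =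
MeasurableSpace.comap Φ written INLINE at the five conditional-expectation sites (rev 1 bound it by
a «let» of class type, which Lean used as a local instance for the three Measurable fields —
artefact, see memo bc/LogConcaveChart_repair_r2.md). The floor on Q2 is derived in the Assembly
through ChartCovarianceTransfer (266 -/
@[route_item "route-QuantumFields-LogConcaveChart"]
def UnitScaleChart : Prop :=
  open MeasureTheory Literature.MathematicalPhysics.QuantumFieldTheory Literature.MathematicalPhysics.QuantumLattice Literature.Probability.LatticeModels Summit.QuantumFields.YangMills.Cruxes.OSLegsFromFemtoAndGap.DlrCollarTransfer in ∀ (G : Type) [Group G] [TopologicalSpace G] [IsTopologicalGroup G] [CompactSpace G], IsCompactSimpleLieGroup G → letI : MeasurableSpace G := borel G; haveI : BorelSpace G := ⟨rfl⟩; ∃ K : ℝ, 0 < K ∧ ∀ δ : ℝ, 0 < δ → ∃ (r : LatticeRep G) (a : ℝ → ℝ), (∀ β, 0 < a β) ∧ Filter.Tendsto a Filter.atTop (nhds 0) ∧ ∃ (v : SchwartzMap (EuclideanSpace ℝ (Fin 4)) ℝ) (ε β₅ Λ₅ : ℝ), tsupport (v : EuclideanSpace ℝ (Fin 4) → ℝ)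 ⊆ {y | 0 < y 0} ∧ 0 < ε ∧ ∀ β : ℝ, β₅ ≤ β → ∀ L : ℕ, Λ₅ ≤ a β * L → ∃ (n : ℕ) (Φ : GaugeConfig 4 (2 * L + 1) G → (Fin n → ℝ)) (H₀ Hf Hg : Matrix (Fin n) (Fin n) ℝ) (bf bg : Fin n → ℝ) (A : (Fin n → ℝ) → ℝ) (R Mb : ℝ), let μ : Measure (GaugeConfig 4 (2 * L + 1) G) := wilsonMeasure (d := 4) (L := 2 * L + 1) r.ρ β; let Af : GaugeConfig 4 (2 * L + 1) G → ℝ := fun U => ∑ y ∈ box 4 L, (thetaTest 4 v) (a β • siteToE y) * dens G r y (torusLift (2 * L + 1) U); let Ag : GaugeConfig 4 (2 * L + 1) G → ℝ := fun U => ∑ y ∈ box 4 L, v (a β • siteToE y) * dens G r y (torusLift (2 * L + 1) U); let gE : ((Fin n → ℝ) → ℝ) → ℝ := fun F => (∫ x, F x * Real.exp (-A x)) / ∫ x, Real.exp (-A x); let f : (Fin n → ℝ) → ℝ := fun x => x ⬝ᵥ Hf.mulVec x + bf ⬝ᵥ x; let g : (Fin n → ℝ) → ℝ := fun x => x ⬝ᵥ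 Hg.mulVec x + bg ⬝ᵥ x; let rC : ℝ := 2 * (H₀⁻¹ * Hf * H₀⁻¹ * Hg).trace + bf ⬝ᵥ H₀⁻¹.mulVec bg; let rVf : ℝ := 2 * (H₀⁻¹ * Hf * H₀⁻¹ * Hf).trace + bf ⬝ᵥ H₀⁻¹.mulVec bf; let rVg : ℝ := 2 * (H₀⁻¹ * Hg * H₀⁻¹ * Hg).trace + bg ⬝ᵥ H₀⁻¹.mulVec bg; Measurable Φ ∧ (∀ U, ‖Φ U‖ ≤ R) ∧ Measurable Af ∧ Measurable Ag ∧ (∀ U, |Af U| ≤ Mb) ∧ (∀ U, |Ag U| ≤ Mb) ∧ H₀.PosDef ∧ Hf.IsSymm ∧ Hg.IsSymm ∧ Continuous A ∧ (∀ x h : Fin n → ℝ, (1 - δ) * (h ⬝ᵥ H₀.mulVec h) ≤ A (x + h) + A (x - h) - 2 * A x ∧ A (x + h) + A (x - h) - 2 * A x ≤ (1 + δ) * (h ⬝ᵥ H₀.mulVec h)) ∧ (∀ i : Fin n, ∫ x, x i * Real.exp (-A x) = 0) ∧ Q2 G r β L (a β) (thetaTest 4 v) v = (∫ U, Af U * Ag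 U ∂μ) - (∫ U, Af U ∂μ) * ∫ U, Ag U ∂μ ∧ |((∫ U, f (Φ U) * g (Φ U) ∂μ) - (∫ U, f (Φ U) ∂μ) * ∫ U, g (Φ U) ∂μ) - (gE (fun x => f x * g x) - gE f * gE g)| ≤ ε ∧ ∫ U, (f (Φ U) - ∫ U', f (Φ U') ∂μ) ^ 2 ∂μ ≤ K * ε ∧ ∫ U, (g (Φ U) - ∫ U', g (Φ U') ∂μ) ^ 2 ∂μ ≤ K * ε ∧ ∫ U, (μ[Af|MeasurableSpace.comap Φ inferInstance] U - f (Φ U)) ^ 2 ∂μ ≤ δ * ε ∧ ∫ U, (μ[Ag|MeasurableSpace.comap Φ inferInstance] U - g (Φ U)) ^ 2 ∂μ ≤ δ * ε ∧ |∫ U, (μ[fun U' => Af U' * Ag U'|MeasurableSpace.comap Φ inferInstance] U - μ[Af|MeasurableSpace.comap Φ inferInstance] U * μ[Ag|MeasurableSpace.comap Φ inferInstance] U) ∂μ| ≤ ε ∧ 8 * ε ≤ rC ∧ 0 ≤ rVf ∧ rVf ≤ K * ε ∧ 0 ≤ rVg ∧ rVg ≤ K * ε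

/-- item stmt-QuantumFields-26240 · crux · rank 3 · closed · proved by Summit.QuantumFields.YangMills.Theorems.logConcaveChart_quadraticCovarianceComparison_proof (prover) · by planner
why it might fail: dimension-freeness rests on the two-sided Caffarelli–Kolesnikov bound for a NON-Gaussian source (‖DT⁻¹‖ ≤ √(1+δ)) under C^(1,1)-only potentials plus E e = 0 from centring; a hidden √n in the e-term would make δ* volume-dependent and kill the assembly.
sources: Caffarelli2000, arXiv:1103.1479, BrascampLieb1976, HelfferSjostrand1994
retired/moot children: SandwichTransportMap [moot: open MeasureTheory in ∀ δ : ℝ, 0 ≤ δ → δ ≤ 1 / 2 → ∀ (n : ℕ) (H₀ : Matrix (Fin n]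
[crux] PURE PROBABILITY (dimension-free log-concave comparison). There are C and δ₀ ∈ (0,1] such
that for 0 ≤ δ ≤ δ₀, every n, H₀ ≻ 0, symmetric H_f, H_g, vectors b_f, b_g and continuous A : ℝⁿ → ℝ
with second differences sandwiched in (1±δ)·hᵀH₀h and ∫ x_i e^(−A) dx = 0 for all i: |Cov_ν(f,g) −
rC| ≤ C·δ·√(rV_f·rV_g), where ν = e^(−A)dx/Z, f = xᵀH_f x + b_fᵀx, g = xᵀH_g x + b_gᵀx, rC = 2
tr(H₀⁻¹H_f H₀⁻¹H_g) + b_fᵀH₀⁻¹b_g and rV_f, rV_g the corresponding Gaussian variances. δ = 0 is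
exact (A is then ½xᵀH₀x + const by centring; Isserlis). [difficulty: L] -/
@[route_item "route-QuantumFields-LogConcaveChart"]
def QuadraticCovarianceComparison : Prop :=
  open MeasureTheory in ∃ (C δ₀ : ℝ), 0 < δ₀ ∧ δ₀ ≤ 1 ∧ ∀ δ : ℝ, 0 ≤ δ → δ ≤ δ₀ → ∀ (n : ℕ) (H₀ Hf Hg : Matrix (Fin n) (Fin n) ℝ) (bf bg : Fin n → ℝ) (A : (Fin n → ℝ) → ℝ), H₀.PosDef → Hf.IsSymm → Hg.IsSymm → Continuous A → (∀ x h : Fin n → ℝ, (1 - δ) * (h ⬝ᵥ H₀.mulVec h) ≤ A (x + h) + A (x - h) - 2 * A x ∧ A (x + h) + A (x - h) - 2 * A x ≤ (1 + δ) * (h ⬝ᵥ H₀.mulVec h)) → (∀ i : Fin n, ∫ x, x i * Real.exp (-A x) = 0) → let gE : ((Fin n → ℝ) → ℝ) → ℝ := fun F => (∫ x, F x * Real.exp (-A x)) / ∫ x, Real.exp (-A x); let f : (Fin n → ℝ) → ℝ := fun x => x ⬝ᵥ Hf.mulVec x + bf ⬝ᵥ x; let g : (Fin n → ℝ) → ℝ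 := fun x => x ⬝ᵥ Hg.mulVec x + bg ⬝ᵥ x; let rC : ℝ := 2 * (H₀⁻¹ * Hf * H₀⁻¹ * Hg).trace + bf ⬝ᵥ H₀⁻¹.mulVec bg; let rVf : ℝ := 2 * (H₀⁻¹ * Hf * H₀⁻¹ * Hf).trace + bf ⬝ᵥ H₀⁻¹.mulVec bf; let rVg : ℝ := 2 * (H₀⁻¹ * Hg * H₀⁻¹ * Hg).trace + bg ⬝ᵥ H₀⁻¹.mulVec bg; |gE (fun x => f x * g x) - gE f * gE g - rC| ≤ C * δ * Real.sqrt (rVf * rVg)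

-- `QuadraticCovarianceComparison` holds: proved by `Summit.QuantumFields.YangMills.Theorems.logConcaveChart_quadraticCovarianceComparison_proof` (its module imports this route file, so no `_holds` link can be stated here).

-- parent: QuadraticCovarianceComparison · child (gen 1)
/--     item stmt-QuantumFields-23668 · support · rank 302 · closed · proved by Summit.QuantumFields.YangMills.Theorems.logConcaveChart_transportCovarianceTransfer (planner)
    parent: QuadraticCovarianceComparison · by planner
    sources: BakryGentilLedoux2014, Bogachev1998, Caffarelli2000
[support · PROVABLE NOW from the tree — the analytic half of the glued split of
QuadraticCovarianceComparison (stmt-QuantumFields-26240), ym-idea-8 g8] TRANSPORT COVARIANCE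
TRANSFER (dimension-free). There is a universal C such that for 0 ≤ δ ≤ 1/2, all n, H₀ ≻ 0,
symmetric H_f, H_g, vectors b_f, b_g, ANY A with ∫ x_i e^(−A) = 0 and ANY C¹ map T that pushes γ =
N(0,H₀⁻¹) to ν = e^(−A)/Z (normalised-integral form, every measurable F) with T − id δ-Lipschitz in
the H₀-metric and ‖DT − I‖_{H₀} ≤ δ: |Cov_ν(f,g) − rC| ≤ C·δ·√(rV_f·rV_g) for f = xᵀH_f x + b_fᵀx, g
likewise, rC/rV the N(0,H₀⁻¹) covariance/variances (texts verbatim from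
QuadraticCovarianceComparison). PROOF PLAN (paper-complete; every ingredient is a tree theorem): (1)
pushforward: Cov_ν(f,g) = Cov_γ(f∘T, g∘T), E_γ[T − id] = 0 from the centring; Z_A ≠ 0 from F = 1.
(2) Gaussian side: Cov_γ(f,g) = rC, Var_γ f = rV_f (Wick:
Literature.Probability.Distributions.integral_eval_four_multivariateGaussian /
integral_eval_mul_eval_pi_gaussianReal after y = Px; density form
pi_gaussianReal_eq_smul_withDensity). (3) remainder R_f := f∘T − f = 2xᵀH_f e + eᵀH_f e + b_f·e is
C¹; Gaussian Poincaré (tree: lintegral_sq_sub_le_pi_gaussianRe -/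
@[route_item "route-QuantumFields-LogConcaveChart"]
def TransportCovarianceTransfer : Prop :=
  open MeasureTheory in ∃ C : ℝ, ∀ δ : ℝ, 0 ≤ δ → δ ≤ 1 / 2 → ∀ (n : ℕ) (H₀ Hf Hg : Matrix (Fin n) (Fin n) ℝ) (bf bg : Fin n → ℝ) (A : (Fin n → ℝ) → ℝ) (T : (Fin n → ℝ) → (Fin n → ℝ)), H₀.PosDef → Hf.IsSymm → Hg.IsSymm → (∀ i : Fin n, ∫ x, x i * Real.exp (-A x) = 0) → ContDiff ℝ 1 T → (∀ F : (Fin n → ℝ) → ℝ, Measurable F → (∫ x, F (T x) * Real.exp (-(x ⬝ᵥ H₀.mulVec x) / 2)) / (∫ x : Fin n → ℝ, Real.exp (-(x ⬝ᵥ H₀.mulVec x) / 2)) = (∫ x, F x * Real.exp (-A x)) / ∫ x, Real.exp (-A x)) → (∀ x y : Fin n → ℝ, (T x - T y - (x - y)) ⬝ᵥ H₀.mulVec (T x - T y - (x - y)) ≤ δ ^ 2 * ((x - y) ⬝ᵥ H₀.mulVec (x - y))) → (∀ x u : Fin n → ℝ, (fderiv ℝ T x u - u) ⬝ᵥ H₀.mulVec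 (fderiv ℝ T x u - u) ≤ δ ^ 2 * (u ⬝ᵥ H₀.mulVec u)) → let gE : ((Fin n → ℝ) → ℝ) → ℝ := fun F => (∫ x, F x * Real.exp (-A x)) / ∫ x, Real.exp (-A x); let f : (Fin n → ℝ) → ℝ := fun x => x ⬝ᵥ Hf.mulVec x + bf ⬝ᵥ x; let g : (Fin n → ℝ) → ℝ := fun x => x ⬝ᵥ Hg.mulVec x + bg ⬝ᵥ x; let rC : ℝ := 2 * (H₀⁻¹ * Hf * H₀⁻¹ * Hg).trace + bf ⬝ᵥ H₀⁻¹.mulVec bg; let rVf : ℝ := 2 * (H₀⁻¹ * Hf * H₀⁻¹ * Hf).trace + bf ⬝ᵥ H₀⁻¹.mulVec bf; let rVg : ℝ := 2 * (H₀⁻¹ * Hg * H₀⁻¹ * Hg).trace + bg ⬝ᵥ H₀⁻¹.mulVec bg; |gE (fun x => f x * g x) - gE f * gE g - rC| ≤ C * δ * Real.sqrt (rVf * rVg)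

-- `TransportCovarianceTransfer` holds: proved by `Summit.QuantumFields.YangMills.Theorems.logConcaveChart_transportCovarianceTransfer` (its module imports this route file, so no `_holds` link can be stated here).

-- parent: QuadraticCovarianceComparison · glue (gen 1)
/--     item stmt-QuantumFields-23669 · support · rank 303 · closed · proved by Summit.QuantumFields.YangMills.Theorems.logConcaveChart_transportSplitGlue (planner)
    parent: QuadraticCovarianceComparison · GLUE: children ⟹ parent · by planner
TRANSPORT SPLIT GLUE (ym-idea-8 g8, LINE g8-1): SandwichTransportMap → TransportCovarianceTransfer →
QuadraticCovarianceComparison. Proof = bookkeeping: take C from the transfer and δ₀ := 1/2; at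
admissible (δ, n, H₀, H_f, H_g, b_f, b_g, A) obtain the C¹ transport map T from SandwichTransportMap
(hypotheses H₀ ≻ 0, A continuous, sandwich) and feed it with the centring to
TransportCovarianceTransfer; the let-bound conclusion is QuadraticCovarianceComparison's verbatim.
Kernel-checked in the seat folder (Sketch8.lean: quadraticCovarianceComparison_of_transport, rc 0, 0
sorry, 12 s); the proof file is proposed right after this edit. No summit / NT / leaf is proved. -/
@[route_item "route-QuantumFields-LogConcaveChart"]
def TransportSplitGlue : Prop :=
  SandwichTransportMap → TransportCovarianceTransfer → QuadraticCovarianceComparison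

-- `TransportSplitGlue` holds: proved by `Summit.QuantumFields.YangMills.Theorems.logConcaveChart_transportSplitGlue` (its module imports this route file, so no `_holds` link can be stated here).

-- earlier SkewAtChartUnit (stmt-QuantumFields-26241, replaced 2026-08-28T07:43:51Z -> stmt-QuantumFields-26750): retired by None — open MeasureTheory Literature.MathematicalPhysics.QuantumFieldTheory Literature.MathematicalPhysics.QuantumLattice Literature.Probability.LatticeModels Summit.QuantumFields.YangMills.Cruxes.OSLegsFromFemtoAndGap.DlrCollarTransfer in ∀ (G : Type) [Group G] [TopologicalSpa
-- earlier SkewAtChartUnit (stmt-QuantumFields-26750, replaced 2026-08-28T08:12:31Z -> stmt-QuantumFields-26932): retired by None — open MeasureTheory Literature.MathematicalPhysics.QuantumFieldTheory Literature.MathematicalPhysics.QuantumLattice Literature.Probability.LatticeModels Summit.QuantumFields.YangMills.Cruxes.OSLegsFromFemtoAndGap.DlrCollarTransfer in ∀ (G : Type) [Group G] [TopologicalSpa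
/-- item stmt-QuantumFields-26932 · crux · rank 4 · open · by planner
why it might fail: It is NT clause (ii) at a deep-UV unit: tree-level skewness of tr F² vanishes (Theorems/SelfNormalisedSkewness/Negative/TreeLevelSkewnessVanishes), so the O(1) floor must come from a one-loop/β-function effect at the chart unit — open, never printed; the chart package gives no handle on Q3.
sources: Balaban1989LargeFieldII
[crux] (RESIDUAL, declared; rev 2: hypothesis = the rev-2 chart package verbatim, σ(Φ) inlined at
the condExp sites — typing artefact of rev 1 removed) NT clause (ii) (three-point skewness Q3
bounded away from 0 for some pairwise-disjoint Schwartz triple, uniformly at large β, L) at any unit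
(r, a) that carries a load-bearing log-concave chart package (some K > 0, 0 < δ ≤ 1, positive-time
mode v, scale ε). NT(ii) pinned to the chart unit; priced as such. -/
@[route_item "route-QuantumFields-LogConcaveChart"]
def SkewAtChartUnit : Prop :=
  open MeasureTheory Literature.MathematicalPhysics.QuantumFieldTheory Literature.MathematicalPhysics.QuantumLattice Literature.Probability.LatticeModels Summit.QuantumFields.YangMills.Cruxes.OSLegsFromFemtoAndGap.DlrCollarTransfer in ∀ (G : Type) [Group G] [TopologicalSpace G] [IsTopologicalGroup G] [CompactSpace G], IsCompactSimpleLieGroup G → letI : MeasurableSpace G := borel G; haveI : BorelSpace G := ⟨rfl⟩; ∀ (r : LatticeRep G) (a : ℝ → ℝ), (∀ β, 0 < a β) → Filter.Tendsto a Filter.atTop (nhds 0) → (∃ (K δ : ℝ) (v : SchwartzMap (EuclideanSpace ℝ (Fin 4)) ℝ) (ε β₅ Λ₅ : ℝ), 0 < K ∧ 0 < δ ∧ δ ≤ 1 ∧ tsupport (v : EuclideanSpace ℝ (Fin 4) → ℝ) ⊆ {y | 0 < y 0} ∧ 0 < ε ∧ ∀ β : ℝ, β₅ ≤ β → ∀ L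 : ℕ, Λ₅ ≤ a β * L → ∃ (n : ℕ) (Φ : GaugeConfig 4 (2 * L + 1) G → (Fin n → ℝ)) (H₀ Hf Hg : Matrix (Fin n) (Fin n) ℝ) (bf bg : Fin n → ℝ) (A : (Fin n → ℝ) → ℝ) (R Mb : ℝ), let μ : Measure (GaugeConfig 4 (2 * L + 1) G) := wilsonMeasure (d := 4) (L := 2 * L + 1) r.ρ β; let Af : GaugeConfig 4 (2 * L + 1) G → ℝ := fun U => ∑ y ∈ box 4 L, (thetaTest 4 v) (a β • siteToE y) * dens G r y (torusLift (2 * L + 1) U); let Ag : GaugeConfig 4 (2 * L + 1) G → ℝ := fun U => ∑ y ∈ box 4 L, v (a β • siteToE y) * dens G r y (torusLift (2 * L + 1) U); let gE : ((Fin n → ℝ) → ℝ) → ℝ := fun F => (∫ x, F x * Real.exp (-A x)) / ∫ x, Real.exp (-A x); let f : (Fin n → ℝ) → ℝ := fun x => x ⬝ᵥ Hf.mulVec x + bf ⬝ᵥ x; let g : (Fin n → ℝ) → ℝ := fun x => x ⬝ᵥ Hg.mulVec x + bg ⬝ᵥ x; let rC : ℝ := 2 * (H₀⁻¹ * Hf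 * H₀⁻¹ * Hg).trace + bf ⬝ᵥ H₀⁻¹.mulVec bg; let rVf : ℝ := 2 * (H₀⁻¹ * Hf * H₀⁻¹ * Hf).trace + bf ⬝ᵥ H₀⁻¹.mulVec bf; let rVg : ℝ := 2 * (H₀⁻¹ * Hg * H₀⁻¹ * Hg).trace + bg ⬝ᵥ H₀⁻¹.mulVec bg; Measurable Φ ∧ (∀ U, ‖Φ U‖ ≤ R) ∧ Measurable Af ∧ Measurable Ag ∧ (∀ U, |Af U| ≤ Mb) ∧ (∀ U, |Ag U| ≤ Mb) ∧ H₀.PosDef ∧ Hf.IsSymm ∧ Hg.IsSymm ∧ Continuous A ∧ (∀ x h : Fin n → ℝ, (1 - δ) * (h ⬝ᵥ H₀.mulVec h) ≤ A (x + h) + A (x - h) - 2 * A x ∧ A (x + h) + A (x - h) - 2 * A x ≤ (1 + δ) * (h ⬝ᵥ H₀.mulVec h)) ∧ (∀ i : Fin n, ∫ x, x i * Real.exp (-A x) = 0) ∧ Q2 G r β L (a β) (thetaTest 4 v) v = (∫ U, Af U * Ag U ∂μ) - (∫ U, Af U ∂μ) * ∫ U, Ag U ∂μ ∧ |((∫ U,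 f (Φ U) * g (Φ U) ∂μ) - (∫ U, f (Φ U) ∂μ) * ∫ U, g (Φ U) ∂μ) - (gE (fun x => f x * g x) - gE f * gE g)| ≤ ε ∧ ∫ U, (f (Φ U) - ∫ U', f (Φ U') ∂μ) ^ 2 ∂μ ≤ K * ε ∧ ∫ U, (g (Φ U) - ∫ U', g (Φ U') ∂μ) ^ 2 ∂μ ≤ K * ε ∧ ∫ U, (μ[Af|MeasurableSpace.comap Φ inferInstance] U - f (Φ U)) ^ 2 ∂μ ≤ δ * ε ∧ ∫ U, (μ[Ag|MeasurableSpace.comap Φ inferInstance] U - g (Φ U)) ^ 2 ∂μ ≤ δ * ε ∧ |∫ U, (μ[fun U' => Af U' * Ag U'|MeasurableSpace.comap Φ inferInstance] U - μ[Af|MeasurableSpace.comap Φ inferInstance] U * μ[Ag|MeasurableSpace.comap Φ inferInstance] U) ∂μ| ≤ ε ∧ 8 * ε ≤ rC ∧ 0 ≤ rVf ∧ rVf ≤ K * ε ∧ 0 ≤ rVg ∧ rVg ≤ K * ε) → ∃ (f g h : SchwartzMap (EuclideanSpace ℝ (Fin 4)) ℝ) (ε β₅ Λ₅ : ℝ),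 Disjoint (tsupport (f : EuclideanSpace ℝ (Fin 4) → ℝ)) (tsupport (g : EuclideanSpace ℝ (Fin 4) → ℝ)) ∧ Disjoint (tsupport (g : EuclideanSpace ℝ (Fin 4) → ℝ)) (tsupport (h : EuclideanSpace ℝ (Fin 4) → ℝ)) ∧ Disjoint (tsupport (f : EuclideanSpace ℝ (Fin 4) → ℝ)) (tsupport (h : EuclideanSpace ℝ (Fin 4) → ℝ)) ∧ 0 < ε ∧ ∀ β : ℝ, β₅ ≤ β → ∀ L : ℕ, Λ₅ ≤ a β * L → ε ≤ |Q3 G r β L (a β) f g h|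

/-- item stmt-QuantumFields-26680 · support · rank 9 · closed · proved by Summit.QuantumFields.YangMills.Theorems.logConcaveChart_chartCovarianceTransfer (planner) · by planner
[support] CHART COVARIANCE TRANSFER (pure probability, provable now; law of total covariance +
Cauchy–Schwarz): for bounded measurable X, Y on a probability space, a measurable chart Φ and
square-integrable proxies p, q: |Cov(X,Y) − Cov(p,q)| ≤ ηc + √ηp(√ηq + sq) + sp√ηq, where ηc bounds
|E[Cov(X,Y | σ(Φ))]|, ηp ≥ ‖E[X|σ(Φ)] − p‖²₂, ηq likewise, sp² ≥ Var p, sq² ≥ Var q. Added rev 1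
after critic VERDICT #15 (idea-crit-9): it is the lemma that makes the chart of UnitScaleChart
load-bearing — the floor on Q2 = Cov(Af,Ag) is read off the chart proxies through ceilings only;
consumed by the repaired Assembly. Sources: GlimmJaffe1987 (conditioning), Mathlib
MeasureTheory.condExp. -/
@[route_item "route-QuantumFields-LogConcaveChart"]
def ChartCovarianceTransfer : Prop :=
  open MeasureTheory in ∀ (Ω : Type) [MeasurableSpace Ω] (μ : Measure Ω) [IsProbabilityMeasure μ] (n : ℕ) (Φ : Ω → (Fin n → ℝ)) (X Y p q : Ω → ℝ) (M ηc ηp ηq sp sq : ℝ), Measurable Φ → Measurable X → Measurable Y → (∀ ω, |X ω| ≤ M) → (∀ ω, |Y ω| ≤ M) → MemLp p 2 μ → MemLp q 2 μ → 0 ≤ ηp → 0 ≤ ηq → 0 ≤ sp → 0 ≤ sq → let m : MeasurableSpace Ω := MeasurableSpace.comap Φ inferInstance; |∫ ω, (μ[fun ω' => X ω' * Y ω'|m] ω - μ[X|m] ω * μ[Y|m] ω) ∂μ| ≤ ηc → ∫ ω, (μ[X|m] ω - p ω) ^ 2 ∂μ ≤ ηp → ∫ ω, (μ[Y|m] ω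 - q ω) ^ 2 ∂μ ≤ ηq → ∫ ω, (p ω - ∫ ω', p ω' ∂μ) ^ 2 ∂μ ≤ sp ^ 2 → ∫ ω, (q ω - ∫ ω', q ω' ∂μ) ^ 2 ∂μ ≤ sq ^ 2 → |((∫ ω, X ω * Y ω ∂μ) - (∫ ω, X ω ∂μ) * ∫ ω, Y ω ∂μ) - ((∫ ω, p ω * q ω ∂μ) - (∫ ω, p ω ∂μ) * ∫ ω, q ω ∂μ)| ≤ ηc + Real.sqrt ηp * (Real.sqrt ηq + sq) + sp * Real.sqrt ηq

-- `ChartCovarianceTransfer` holds: proved by `Summit.QuantumFields.YangMills.Theorems.logConcaveChart_chartCovarianceTransfer` (its module imports this route file, so no `_holds` link can be stated here).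

-- earlier Assembly (stmt-QuantumFields-26242, replaced 2026-08-28T07:46:31Z -> stmt-QuantumFields-26773): retired by None — QuadraticCovarianceComparison → UnitScaleChart → SkewAtChartUnit → Summit.QuantumFields.YangMills.Theses.BalabanLadder.NT
/-- item stmt-QuantumFields-26773 · assembly · rank 1 · closed · proved by Summit.QuantumFields.YangMills.Theorems.logConcaveChart_assembly (planner) · by planner
sources: Caffarelli2000
[assembly] (rev 1) from QuadraticCovarianceComparison take C, δ₀; for G take K from UnitScaleChart
(WLOG K ≥ 1), put δ := min δ₀ (min (1/2) (1/(16·K·(|C|+1)²))), obtain (r,a), v, ε; at every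
admissible (β,L): Q2 = Cov_μ(Af,Ag) (package identity) ≥ Cov_μ(f∘Φ,g∘Φ) − ε − ε(δ + 2√(δK))
(ChartCovarianceTransfer with X,Y := Af,Ag, p,q := f∘Φ,g∘Φ, ηc := ε, ηp = ηq := δε, sp = sq :=
√(Kε)) ≥ Cov_ν(f,g) − 2ε − ε(δ + 2√(δK)) (law closeness) ≥ rC − |C|δ√(rVf·rVg) − 3.5ε ≥ 8ε − ε/4 −
3.5ε ≥ ε = clause (i) of LowerBounds; clause (ii) is SkewAtChartUnit at the same unit (its
hypothesis is the package with this δ ≤ 1). -/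
@[route_item "route-QuantumFields-LogConcaveChart"]
def Assembly : Prop :=
  QuadraticCovarianceComparison → ChartCovarianceTransfer → UnitScaleChart → SkewAtChartUnit → Summit.QuantumFields.YangMills.Theses.BalabanLadder.NT

-- `Assembly` holds: proved by `Summit.QuantumFields.YangMills.Theorems.logConcaveChart_assembly` (its module imports this route file, so no `_holds` link can be stated here).

/-! D-0027 §2.1 — DECIDING THEOREM (planner-authored via `route open/edit --closes-file`; by planner-ym-idea-8-g2-0 2026-08-28T07:46:31Z):
its hypotheses are this route's items and its conclusion the registered leaf `Summit.QuantumFields.YangMills.Theses.BalabanLadder.NT` (rung R2a, D-0061) (glue_lint), and it elaborates with this file. -/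

@[closes "route-QuantumFields-LogConcaveChart"] theorem closes (hA : Assembly) (h0 : ChartCovarianceTransfer) (h1 : QuadraticCovarianceComparison) (h2 : UnitScaleChart)
    (h3 : SkewAtChartUnit) :
    Summit.QuantumFields.YangMills.Theses.BalabanLadder.NT :=
  hA h1 h0 h2 h3

end Summit.QuantumFields.YangMills.Theses.LogConcaveChart
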